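import Summits.CriticalPhenomena.PercolationContinuityZ3.Theorems.PercNearOneGluingNoHeavyQuantTwoLevelLightBlock
import Summits.CriticalPhenomena.PercolationContinuityZ3.Theorems.PercNearOneGluingNoHeavyQuantFarTreeHubTopBlock
import HarnessLib

/-!
# QUANT lane R8, FAR on trees: the far-relay row for the branching family "hub with leaves + one root block" — ALL LAYERS
# (gate coordinates; the vocabulary of `Quant.tree_relayCount_transfer` / `Quant.FarTreeRow`)

builds on p205010 (kernel theorem, internal audit signed; external expert review pending)

Support file (`--supports stmt-CriticalPhenomena-4575`), QUANT lane typer seat prim-quant-stmt (gen 10); memo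
`run/shared/lean/prim/quant/prim-quant-stmt-g10/TLB-NOTES.md` §5–§7; companions `…QuantFarTreeHubTopBlock.lean` (the block's own layer),
`…QuantTwoLevelLightBlock.lean` (`Quant.twoLevel_lightBlock_tree`), `…QuantPoissonBinomialRatio.lean` ("the atom beats the tail").
Theorems only; no definitions, no sorries, standard axioms.

**The family** (LEAD-NOTES-G6 N14 (4), "loose hub + root block" — the first branching tree family beyond spiders): observer `o`; a hub `h`
(gate `q h`) whose children are leaf relays `L` (arbitrary gates); a second child `b` of `o` (gate `q b`) carrying a glued block (`b` and the
relays `B` below it, gate `1`); relay set `A = L ∪ {b} ∪ B`; independent vertex gates (`prodBernoulli q` on `Set (Fin n)`), a relay counted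
iff its ancestral line is open — the right-hand side of `Quant.tree_relayCount_transfer`.

* `Quant.farTree_hubBlock` — **FAR at EVERY layer `j` for this family**: if `2j < q h · Σ_{ℓ∈L} q ℓ + (|B|+1) · q b` (the mean hypothesis
  `2j < Σ_{a∈A} P(a reached)`) and `t ≥ 1 − q b`, `t ≥ 1 − q h · q ℓ₀` (`ℓ₀` a least reliable leaf; the cut hypotheses at the two candidates for
  the least likely relay) then `P(#{a ∈ A counted} ≤ j) ≤ t`.  Layers `j ≤ |B|`: the block alone.  Layers `j ≥ |B| + 1`:
  `{count ≥ j+1} ⊇ {h open, ≥ j+1 leaves} ⊔ {h open, j+1−a ≤ #leaves ≤ j, block open}` (`a = |B|+1`), independence of the coordinate groups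
  `{h}`, `L`, `{b} ∪ B`, the leaves read as `prodBernoulli (q|_L)` (`Quant.prodBernoulli_real_leafCount`), and `Quant.twoLevel_lightBlock_tree`
  (whose inputs are the Poisson ratio bound / "atom beats tail" `Quant.pb_tail_le_atom`, the star row `Quant.halfMean_smallBall` and the
  top-block mean identity).  No regime or cardinality hypothesis.
* `Quant.farRelayRow_hubBlock` — the same in the ROUTE vocabulary: for every weight function on `Sym2 (Fin n)` supported on such a tree, the body of
  `Quant.FarRelayRow` for `A = L ∪ {b} ∪ B` (one rewrite with `tree_relayCount_transfer`, marginals by `tree_real_openConn_eq_prod`).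
[cite: KozmaNitzan2024, Conjecture 3 (p. 15)] (the gluing rows served); the family result is [this work].
-/

noncomputable section

namespace Summit.CriticalPhenomena.PercolationContinuityZ3.Theorems

namespace Quant

open Finset MeasureTheory
open Literature.Probability.LatticeModels
open Literature.Probability.Percolation
open scoped Classical

variable {n : ℕ}

/-- **FAR at every layer for the family "hub with leaves + one root block" (gate coordinates).**  Vertices `Fin n` with independent
gates `q`; observer `o`; hub `h` with leaf relays `L` (parent `h`, depth `1`, `ℓ₀ ∈ L` least reliable); block vertex `b`
(parent `o`, depth `0`) with further block relays `B` (parent `b`, depth `1`, gates `1`); `h, b ∉ L`, `h, b ∉ B`, `L ∩ B = ∅`, `h ≠ b`;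
relays `A = L ∪ {b} ∪ B`; any layer `j`.  If `2j < q h · Σ_{ℓ∈L} q ℓ + (|B|+1) · q b` and `1 − q b ≤ t`, `1 − q h · q ℓ₀ ≤ t`, then
`P(#{a ∈ A | a = o ∨ all ancestral gates open} ≤ j) ≤ t`.  Via `Quant.twoLevel_lightBlock_tree` (memo §5–§7). [this work] -/
theorem farTree_hubBlock (q : Fin n → unitInterval) (o h b ℓ₀ : Fin n) (L B : Finset (Fin n))
    (depth : Fin n → ℕ) (par : Fin n → Fin n) (j : ℕ) (t : ℝ)
    (hb : par b = o ∧ depth b = 0) (hhb : h ≠ b)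
    (hL : ∀ a ∈ L, par a = h ∧ depth a = 1) (hB : ∀ a ∈ B, par a = b ∧ depth a = 1)
    (hhL : h ∉ L) (hbL : b ∉ L) (hhB : h ∉ B) (hbB : b ∉ B) (hLB : Disjoint L B) (hℓ₀ : ℓ₀ ∈ L)
    (hmin : ∀ a ∈ L, (q ℓ₀ : ℝ) ≤ q a) (hqB : ∀ a ∈ B, (q a : ℝ) = 1)
    (hEN : (2 * j : ℝ) < (q h : ℝ) * ∑ a ∈ L, (q a : ℝ) + ((B.card : ℝ) + 1) * (q b : ℝ))
    (htb : 1 - (q b : ℝ) ≤ t) (htℓ : 1 - (q h : ℝ) * (q ℓ₀ : ℝ) ≤ t) :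
    (prodBernoulli q).real {ω' : Set (Fin n) |
      ((L ∪ insert b B).filter fun a => a = o ∨ ∀ i, i ≤ depth a → par^[i] a ∈ ω').card ≤ j} ≤ t := by
  set μ := prodBernoulli q with hμ
  set A : Finset (Fin n) := L ∪ insert b B with hA
  set cnt : Set (Fin n) → ℕ := fun ω' => (A.filter fun a => a = o ∨ ∀ i, i ≤ depth a → par^[i] a ∈ ω').card with hcnt
  set X : Set (Fin n) → ℕ := fun ω' => (L.filter fun a => a ∈ ω').card with hX
  have hmeas : ∀ S : Set (Set (Fin n)), MeasurableSet S := fun S => MeasurableSet.of_discrete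
  have hG0 : (0 : ℝ) ≤ q h := (q h).2.1
  have hG1 : (q h : ℝ) ≤ 1 := (q h).2.2
  have hg0 : (0 : ℝ) ≤ q b := (q b).2.1
  -- degenerate gates: the bound is trivial
  by_cases hGpos : (q h : ℝ) = 0
  · have : 1 ≤ t := by rw [hGpos, zero_mul, sub_zero] at htℓ; exact htℓ
    exact le_trans measureReal_le_one this
  by_cases hgpos : (q b : ℝ) = 0
  · have : 1 ≤ t := by rw [hgpos, sub_zero] at htb; exact htb
    exact le_trans measureReal_le_one this
  have hGpos' : 0 < (q h : ℝ) := lt_of_le_of_ne hG0 (Ne.symm hGpos)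
  have hgpos' : 0 < (q b : ℝ) := lt_of_le_of_ne hg0 (Ne.symm hgpos)
  have hg1 : (q b : ℝ) ≤ 1 := (q b).2.2
  set a : ℕ := B.card + 1 with ha
  -- what is counted: sufficient conditions
  have cnt_leaf : ∀ ω' : Set (Fin n), h ∈ ω' → ∀ a ∈ L, a ∈ ω' →
      a ∈ A.filter fun a => a = o ∨ ∀ i, i ≤ depth a → par^[i] a ∈ ω' := by
    intro ω' hhω a haL haω
    rw [Finset.mem_filter]
    refine ⟨Finset.mem_union_left _ haL, Or.inr fun i hi => ?_⟩
    obtain ⟨hpa, hda⟩ := hL a haL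
    rw [hda] at hi
    interval_cases i
    · simpa using haω
    · simpa [hpa] using hhω
  have cnt_b : ∀ ω' : Set (Fin n), b ∈ ω' → b ∈ A.filter fun a => a = o ∨ ∀ i, i ≤ depth a → par^[i] a ∈ ω' := by
    intro ω' hbω
    rw [Finset.mem_filter]
    refine ⟨Finset.mem_union_right _ (Finset.mem_insert_self _ _), Or.inr fun i hi => ?_⟩
    rw [hb.2] at hi
    interval_cases i
    simpa using hbω
  have cnt_B : ∀ ω' : Set (Fin n), b ∈ ω' → ∀ a ∈ B, a ∈ ω' →
      a ∈ A.filter fun a => a = o ∨ ∀ i, i ≤ depth a → par^[i] a ∈ ω' := by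
    intro ω' hbω a haB haω
    rw [Finset.mem_filter]
    refine ⟨Finset.mem_union_right _ (Finset.mem_insert_of_mem haB), Or.inr fun i hi => ?_⟩
    obtain ⟨hpa, hda⟩ := hB a haB
    rw [hda] at hi
    interval_cases i
    · simpa using haω
    · simpa [hpa] using hbω
  -- low layers `j + 1 ≤ a`: the block alone reaches the level
  set K : Set (Set (Fin n)) := {ω' | ((insert b B : Finset (Fin n)) : Set (Fin n)) ⊆ ω'} with hK
  have hPK : μ.real K = q b := by
    rw [hK, hμ, prodBernoulli_real_subset, Finset.prod_insert hbB]
    rw [Finset.prod_eq_one fun a ha => hqB a ha, mul_one]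
  by_cases haj : a ≤ j
  swap
  · have hsubK : K ⊆ {ω' | j + 1 ≤ cnt ω'} := by
      intro ω' hKω
      have hbω : b ∈ ω' := hKω (Finset.mem_coe.2 (Finset.mem_insert_self _ _))
      have hincl : insert b B ⊆ A.filter fun a => a = o ∨ ∀ i, i ≤ depth a → par^[i] a ∈ ω' := by
        intro x hx
        rcases Finset.mem_insert.1 hx with rfl | hxB
        · exact cnt_b ω' hbω
        · exact cnt_B ω' hbω x hxB (hKω (Finset.mem_coe.2 (Finset.mem_insert_of_mem hxB)))
      have hcard := Finset.card_le_card hincl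
      rw [Finset.card_insert_of_notMem hbB] at hcard
      show j + 1 ≤ (A.filter fun a => a = o ∨ ∀ i, i ≤ depth a → par^[i] a ∈ ω').card
      omega
    have hcompl0 : μ.real {ω' | cnt ω' ≤ j} = 1 - μ.real {ω' | j + 1 ≤ cnt ω'} := by
      have : {ω' : Set (Fin n) | cnt ω' ≤ j} = {ω' | j + 1 ≤ cnt ω'}ᶜ := by
        ext ω'; simp only [Set.mem_setOf_eq, Set.mem_compl_iff]; omega
      rw [this, probReal_compl_eq_one_sub (hmeas _)]
    rw [hcompl0]
    have := measureReal_mono hsubK (measure_ne_top _ _) (μ := μ)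
    rw [hPK] at this
    linarith
  -- the two disjoint sub-events of `{cnt ≥ j+1}`
  set H : Set (Set (Fin n)) := {ω' | h ∈ ω'} with hH
  set E1 : Set (Set (Fin n)) := {ω' | j + 1 ≤ X ω'} with hE1
  set E2 : Set (Set (Fin n)) := {ω' | j + 1 - a ≤ X ω' ∧ X ω' ≤ j} with hE2
  have hsub1 : H ∩ E1 ⊆ {ω' | j + 1 ≤ cnt ω'} := by
    rintro ω' ⟨hhω, hE⟩
    have hincl : (L.filter fun a => a ∈ ω') ⊆ A.filter fun a => a = o ∨ ∀ i, i ≤ depth a → par^[i] a ∈ ω' := by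
      intro a ha
      rw [Finset.mem_filter] at ha
      exact cnt_leaf ω' hhω a ha.1 ha.2
    have := Finset.card_le_card hincl
    show j + 1 ≤ cnt ω'
    exact le_trans hE this
  have hsub2 : H ∩ (E2 ∩ K) ⊆ {ω' | j + 1 ≤ cnt ω'} := by
    rintro ω' ⟨hhω, ⟨hE1', -⟩, hKω⟩
    have hbω : b ∈ ω' := hKω (Finset.mem_coe.2 (Finset.mem_insert_self _ _))
    have hincl : (L.filter fun a => a ∈ ω') ∪ insert b B ⊆
        A.filter fun a => a = o ∨ ∀ i, i ≤ depth a → par^[i] a ∈ ω' := by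
      intro a ha
      rcases Finset.mem_union.1 ha with ha | ha
      · rw [Finset.mem_filter] at ha
        exact cnt_leaf ω' hhω a ha.1 ha.2
      · rcases Finset.mem_insert.1 ha with rfl | haB
        · exact cnt_b ω' hbω
        · exact cnt_B ω' hbω a haB (hKω (Finset.mem_coe.2 (Finset.mem_insert_of_mem haB)))
    have hdisj : Disjoint (L.filter fun a => a ∈ ω') (insert b B) := by
      rw [Finset.disjoint_left]
      intro a ha ha'
      rw [Finset.mem_filter] at ha
      rcases Finset.mem_insert.1 ha' with rfl | haB
      · exact hbL ha.1
      · exact Finset.disjoint_left.1 hLB ha.1 haB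
    have hcard := Finset.card_le_card hincl
    rw [Finset.card_union_of_disjoint hdisj, Finset.card_insert_of_notMem hbB] at hcard
    have h1L : j + 1 - a ≤ (L.filter fun a => a ∈ ω').card := hE1'
    show j + 1 ≤ (A.filter fun a => a = o ∨ ∀ i, i ≤ depth a → par^[i] a ∈ ω').card
    omega
  have hdisjE : Disjoint (H ∩ E1) (H ∩ (E2 ∩ K)) := by
    rw [Set.disjoint_left]
    rintro ω' ⟨-, h1⟩ ⟨-, ⟨-, h2⟩, -⟩
    have h1' : j + 1 ≤ X ω' := h1
    omega
  -- probability bookkeeping: `P(cnt ≤ j) = 1 − P(cnt ≥ j+1) ≤ 1 − P(H ∩ E1) − P(H ∩ E2 ∩ K)`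
  have hcompl : μ.real {ω' | cnt ω' ≤ j} = 1 - μ.real {ω' | j + 1 ≤ cnt ω'} := by
    have : {ω' : Set (Fin n) | cnt ω' ≤ j} = {ω' | j + 1 ≤ cnt ω'}ᶜ := by
      ext ω'; simp only [Set.mem_setOf_eq, Set.mem_compl_iff]; omega
    rw [this, probReal_compl_eq_one_sub (hmeas _)]
  have hlow : μ.real (H ∩ E1) + μ.real (H ∩ (E2 ∩ K)) ≤ μ.real {ω' | j + 1 ≤ cnt ω'} := by
    rw [← measureReal_union hdisjE (hmeas _)]
    exact measureReal_mono (Set.union_subset hsub1 hsub2) (measure_ne_top _ _)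
  -- independence of the coordinate groups `{h}`, `L`, `insert b B`
  have hdetH : DeterminedBy H (↑({h} : Finset (Fin n)) : Set (Fin n)) := by
    rw [determinedBy_iff]
    intro ω ω' hagree
    have hhS : h ∈ (↑({h} : Finset (Fin n)) : Set (Fin n)) := by simp
    show h ∈ ω ↔ h ∈ ω'
    constructor
    · intro hω
      have : h ∈ ω ∩ ↑({h} : Finset (Fin n)) := ⟨hω, hhS⟩
      rw [hagree] at this
      exact this.1
    · intro hω
      have : h ∈ ω' ∩ ↑({h} : Finset (Fin n)) := ⟨hω, hhS⟩
      rw [← hagree] at this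
      exact this.1
  have hdetE1 : DeterminedBy E1 (↑L : Set (Fin n)) := determinedBy_of_filter L (fun F => j + 1 ≤ F.card)
  have hdetE2 : DeterminedBy E2 (↑L : Set (Fin n)) := determinedBy_of_filter L (fun F => j + 1 - a ≤ F.card ∧ F.card ≤ j)
  have hdetK : DeterminedBy K (↑(insert b B) : Set (Fin n)) := by
    rw [determinedBy_iff]
    intro ω ω' hagree
    show ((insert b B : Finset (Fin n)) : Set (Fin n)) ⊆ ω ↔ ((insert b B : Finset (Fin n)) : Set (Fin n)) ⊆ ω'
    constructor
    · intro hω x hx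
      have : x ∈ ω ∩ ↑(insert b B) := ⟨hω hx, hx⟩
      rw [hagree] at this
      exact this.1
    · intro hω x hx
      have : x ∈ ω' ∩ ↑(insert b B) := ⟨hω hx, hx⟩
      rw [← hagree] at this
      exact this.1
  have hdetE2K : DeterminedBy (E2 ∩ K) (↑(L ∪ insert b B) : Set (Fin n)) := by
    refine DeterminedBy.inter (hdetE2.mono ?_) (hdetK.mono ?_)
    · intro x hx; exact Finset.mem_coe.2 (Finset.mem_union_left _ (Finset.mem_coe.1 hx))
    · intro x hx; exact Finset.mem_coe.2 (Finset.mem_union_right _ (Finset.mem_coe.1 hx))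
  have hdj1 : Disjoint ({h} : Finset (Fin n)) L := Finset.disjoint_singleton_left.2 hhL
  have hdj2 : Disjoint ({h} : Finset (Fin n)) (L ∪ insert b B) := by
    rw [Finset.disjoint_singleton_left, Finset.mem_union, Finset.mem_insert, not_or, not_or]
    exact ⟨hhL, hhb, hhB⟩
  have hdj3 : Disjoint L (insert b B) := by
    rw [Finset.disjoint_insert_right]; exact ⟨hbL, hLB⟩
  have hPH : μ.real H = q h := prodBernoulli_real_setOf_mem q h
  have hP1 : μ.real (H ∩ E1) = q h * μ.real E1 := by
    rw [prodBernoulli_real_inter_of_determinedBy_disjoint q hdj1 hdetH hdetE1 (hmeas _) (hmeas _), hPH]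
  have hP2 : μ.real (H ∩ (E2 ∩ K)) = q h * (q b * μ.real E2) := by
    rw [prodBernoulli_real_inter_of_determinedBy_disjoint q hdj2 hdetH hdetE2K (hmeas _) (hmeas _), hPH,
      prodBernoulli_real_inter_of_determinedBy_disjoint q hdj3 hdetE2 hdetK (hmeas _) (hmeas _), hPK, mul_comm (μ.real E2)]
  -- the leaf events as events of `prodBernoulli (q|_L)` and the two-level inequality
  set p : ↥L → unitInterval := fun a => q a with hp
  have hLne : L.Nonempty := ⟨ℓ₀, hℓ₀⟩
  have hE1' : μ.real E1 = (prodBernoulli p).real {s : Set ↥L | j + 1 ≤ 0 + (univ.filter fun i => i ∈ s).card} := by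
    have := prodBernoulli_real_leafCount q L hLne (fun m => j + 1 ≤ 0 + m)
    simp only [zero_add] at this ⊢
    exact this
  have hE2' : μ.real E2 = (prodBernoulli p).real {s : Set ↥L | j + 1 - a ≤ 0 + (univ.filter fun i => i ∈ s).card ∧
      0 + (univ.filter fun i => i ∈ s).card ≤ j} := by
    have := prodBernoulli_real_leafCount q L hLne (fun m => j + 1 - a ≤ 0 + m ∧ 0 + m ≤ j)
    simp only [zero_add] at this ⊢
    exact this
  have hsumL : ∑ i : ↥L, (p i : ℝ) = ∑ a ∈ L, (q a : ℝ) := by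
    rw [hp]; exact Finset.sum_coe_sort L (fun a => (q a : ℝ))
  have hEN' : (2 * j : ℝ) < (q h : ℝ) * ((0 : ℕ) + ∑ i : ↥L, (p i : ℝ)) + a * (q b : ℝ) := by
    rw [hsumL]; push_cast; rw [zero_add, ha]; push_cast; exact hEN
  have hmin' : ∀ i : ↥L, ((p ⟨ℓ₀, hℓ₀⟩ : unitInterval) : ℝ) ≤ p i := fun i => hmin i i.2
  have key := twoLevel_lightBlock_tree p 0 j a (q h) (q b) hGpos' hG1 hgpos' hg1 (by omega) haj ⟨ℓ₀, hℓ₀⟩ hmin' hEN'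
  rw [← hE1', ← hE2'] at key
  -- assemble
  have hθ : 1 - t ≤ min ((q b : unitInterval) : ℝ) ((q h : ℝ) * p ⟨ℓ₀, hℓ₀⟩) := by
    rw [le_min_iff]; constructor
    · linarith
    · show 1 - t ≤ (q h : ℝ) * (q ℓ₀ : ℝ); linarith
  rw [hcompl]
  have : 1 - t ≤ μ.real {ω' | j + 1 ≤ cnt ω'} := by
    calc 1 - t ≤ min ((q b : unitInterval) : ℝ) ((q h : ℝ) * p ⟨ℓ₀, hℓ₀⟩) := hθ
      _ ≤ (q h : ℝ) * (μ.real E1 + (q b : ℝ) * μ.real E2) := key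
      _ = μ.real (H ∩ E1) + μ.real (H ∩ (E2 ∩ K)) := by rw [hP1, hP2]; ring
      _ ≤ μ.real {ω' | j + 1 ≤ cnt ω'} := hlow
  linarith

/-- **FAR for "hub + one root block" in the ROUTE vocabulary (bond percolation with tree-supported weights on `Sym2 (Fin n)`).**  Weights `w`
supported on a rooted tree with coordinates `par`/`depth` (as in `Quant.tree_relayCount_transfer`) in which the hub `h` and the block vertex
`b` are children of the observer `o` (depth `0`), the leaf relays `L` are children of `h` and the block relays `B` are children of `b` glued by
weight `1` (depth `1`).  Then the body of `Quant.FarRelayRow` holds for `A = L ∪ {b} ∪ B` at every layer `j`: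
`2j < Σ_{a∈A} P_w(o ↔ a)` and `P_w(o ↮ a) ≤ t` on `A` imply `P_w(#{a ∈ A | o ↔ a} ≤ j) ≤ t`.  One rewrite with
`tree_relayCount_transfer`, marginals by `tree_real_openConn_eq_prod`, then `farTree_hubBlock`. [this work] -/
theorem farRelayRow_hubBlock (w : Sym2 (Fin n) → unitInterval) (o h b ℓ₀ : Fin n) (L B : Finset (Fin n))
    (depth : Fin n → ℕ) (par : Fin n → Fin n) (j : ℕ) (t : ℝ)
    (hroot : ∀ x, x ≠ o → depth x = 0 → par x = o)
    (hstep : ∀ x, x ≠ o → depth x ≠ 0 → par x ≠ o ∧ depth (par x) + 1 = depth x)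
    (hsupp : ∀ e, w e ≠ 0 → e.IsDiag ∨ ∃ x, x ≠ o ∧ e = s(par x, x))
    (hho : h ≠ o) (hbo : b ≠ o) (hoL : o ∉ L) (hoB : o ∉ B) (hh : depth h = 0) (hb : depth b = 0) (hhb : h ≠ b)
    (hL : ∀ a ∈ L, par a = h ∧ depth a = 1) (hB : ∀ a ∈ B, par a = b ∧ depth a = 1)
    (hhL : h ∉ L) (hbL : b ∉ L) (hhB : h ∉ B) (hbB : b ∉ B) (hLB : Disjoint L B) (hℓ₀ : ℓ₀ ∈ L)
    (hmin : ∀ a ∈ L, (w s(h, ℓ₀) : ℝ) ≤ w s(h, a)) (hwB : ∀ a ∈ B, (w s(b, a) : ℝ) = 1)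
    (hEN : (2 * j : ℝ) < ∑ a ∈ L ∪ insert b B, (prodBernoulli w).real (openConn o a))
    (ht : ∀ a ∈ L ∪ insert b B, (prodBernoulli w).real (openConn o a : Set (BondConfig (Fin n)))ᶜ ≤ t) :
    (prodBernoulli w).real {ω : BondConfig (Fin n) |
      ((L ∪ insert b B).filter fun a => ω ∈ openConn o a).card ≤ j} ≤ t := by
  rw [tree_relayCount_transfer n w o depth par hroot hstep hsupp (L ∪ insert b B) j]
  set q : Fin n → unitInterval := fun x => if x = o then 1 else w s(par x, x) with hq
  have hmeasW : ∀ S : Set (BondConfig (Fin n)), MeasurableSet S := fun S => (Set.toFinite S).measurableSet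
  have hph : par h = o := hroot h hho hh
  have hpb : par b = o := hroot b hbo hb
  have hqh : q h = w s(o, h) := by simp only [hq, if_neg hho, hph]
  have hqb : q b = w s(o, b) := by simp only [hq, if_neg hbo, hpb]
  have hqL : ∀ a ∈ L, q a = w s(h, a) := by
    intro a ha
    have hao : a ≠ o := fun hao => hoL (hao ▸ ha)
    simp only [hq, if_neg hao, (hL a ha).1]
  have hqB : ∀ a ∈ B, (q a : ℝ) = 1 := by
    intro a ha
    have hao : a ≠ o := fun hao => hoB (hao ▸ ha)
    simp only [hq, if_neg hao, (hB a ha).1]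
    exact hwB a ha
  -- marginals
  have hmL : ∀ a ∈ L, (prodBernoulli w).real (openConn o a) = (q h : ℝ) * q a := by
    intro a ha
    have hao : a ≠ o := fun hao => hoL (hao ▸ ha)
    rw [tree_real_openConn_eq_prod n w o depth par hroot hstep hsupp a hao, (hL a ha).2,
      Finset.prod_range_succ, Finset.prod_range_one, Function.iterate_zero_apply, Function.iterate_one,
      (hL a ha).1, hph, hqh, hqL a ha, mul_comm]
  have hmb : (prodBernoulli w).real (openConn o b) = q b := by
    rw [tree_real_openConn_eq_prod n w o depth par hroot hstep hsupp b hbo, hb, Finset.prod_range_one,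
      Function.iterate_zero_apply, hpb, hqb]
  have hmB : ∀ a ∈ B, (prodBernoulli w).real (openConn o a) = q b := by
    intro a ha
    have hao : a ≠ o := fun hao => hoB (hao ▸ ha)
    rw [tree_real_openConn_eq_prod n w o depth par hroot hstep hsupp a hao, (hB a ha).2,
      Finset.prod_range_succ, Finset.prod_range_one, Function.iterate_zero_apply, Function.iterate_one,
      (hB a ha).1, hpb, hqb, hwB a ha, one_mul]
  -- the mean hypothesis in gate form
  have hdisjLB : Disjoint L (insert b B) := by
    rw [Finset.disjoint_insert_right]; exact ⟨hbL, hLB⟩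
  have hEN' : (2 * j : ℝ) < (q h : ℝ) * ∑ a ∈ L, (q a : ℝ) + ((B.card : ℝ) + 1) * (q b : ℝ) := by
    rw [Finset.sum_union hdisjLB, Finset.sum_insert hbB, Finset.sum_congr rfl hmL, Finset.sum_congr rfl hmB, hmb,
      ← Finset.mul_sum, Finset.sum_const, nsmul_eq_mul] at hEN
    linarith
  have htb : 1 - (q b : ℝ) ≤ t := by
    have := ht b (Finset.mem_union_right _ (Finset.mem_insert_self _ _))
    rw [probReal_compl_eq_one_sub (hmeasW _), hmb] at this
    exact this
  have htℓ : 1 - (q h : ℝ) * (q ℓ₀ : ℝ) ≤ t := by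
    have := ht ℓ₀ (Finset.mem_union_left _ hℓ₀)
    rw [probReal_compl_eq_one_sub (hmeasW _), hmL ℓ₀ hℓ₀] at this
    exact this
  have hmin' : ∀ a ∈ L, (q ℓ₀ : ℝ) ≤ q a := by
    intro a ha
    rw [hqL ℓ₀ hℓ₀, hqL a ha]
    exact hmin a ha
  exact farTree_hubBlock q o h b ℓ₀ L B depth par j t ⟨hpb, hb⟩ hhb hL hB hhL hbL hhB hbB hLB hℓ₀ hmin' hqB hEN' htb htℓ

end Quant

end Summit.CriticalPhenomena.PercolationContinuityZ3.Theorems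

end
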